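import Mathlib
import Summits.ABC.ABC.Theses.IneffectiveSubspace

/-!
# Stub `stub_reciprocitySieve` of line `SketchIdeator5` — crux `IneffectiveSubspace.TowerFourSubLiouville` (stmt-ABC-1649)

Stratum S0 of the round-2 card `Ideas/two-division-descent-anchor.md` (the companion of `cm-hall-lang-transfer`):
NECESSARY LOCAL CONDITIONS on a coprime violator `w Z⁴ = v Y⁴ + a` (`a > 0`) of the crux's Thue normal form —

* every prime `p ∣ Z` has `p ∤ a v` and `−a v ≡ □ (mod p)` (indeed `−a v ≡ (v Y²)² (mod p)`): the primes of `Z` split in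
  the 2-division field `ℚ(√(−a v))` of the CM curve `y² = x³ + a v w² x`;
* every prime `p ∣ Y` has `p ∤ a w` and `a w ≡ □ (mod p)` (indeed `a w ≡ (w Z²)² (mod p)`): the primes of `Y` split in
  `ℚ(√(a w))`.

So a coefficient triple `(a, v, w)` and a height `Z` (resp. `Y`) failing these Legendre-symbol conditions carry NO violator —
a reciprocity sieve with no analogue in the Thue-inequality coordinates of the dead round-1 lines.  Elementary
(reduction mod `p` in `ZMod p`); registered as a stub of the line so that it lands `--supports stmt-ABC-1649` for the
census / the standing disprover.  Nothing positive about the crux is asserted.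
-/

-- `Summit.ABC.ABC` is the mandated summit-side namespace (CONVENTIONS §2); the duplicate is deliberate.
set_option linter.dupNamespace false

namespace Summit.ABC.ABC.Theorems.TowerFourSubLiouville

/-- If a prime `p` divides `Z` and `gcd(vY, wZ) = 1`, then `p ∤ v` and `p ∤ Y`. -/
theorem reciprocitySieve_not_dvd_of_dvd_Z {v w Y Z p : ℕ} (hp : p.Prime) (hcop : Nat.Coprime (v * Y) (w * Z))
    (hpZ : p ∣ Z) : ¬ p ∣ v ∧ ¬ p ∣ Y := by
  have hpWZ : p ∣ w * Z := Dvd.dvd.mul_left hpZ w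
  have key : ¬ p ∣ v * Y := fun h =>
    hp.one_lt.ne' (Nat.dvd_one.mp (hcop ▸ Nat.dvd_gcd h hpWZ))
  exact ⟨fun h => key (Dvd.dvd.mul_right h Y), fun h => key (Dvd.dvd.mul_left h v)⟩

/-- If a prime `p` divides `Y` and `gcd(vY, wZ) = 1`, then `p ∤ w` and `p ∤ Z`. -/
theorem reciprocitySieve_not_dvd_of_dvd_Y {v w Y Z p : ℕ} (hp : p.Prime) (hcop : Nat.Coprime (v * Y) (w * Z))
    (hpY : p ∣ Y) : ¬ p ∣ w ∧ ¬ p ∣ Z := by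
  have hpVY : p ∣ v * Y := Dvd.dvd.mul_left hpY v
  have key : ¬ p ∣ w * Z := fun h =>
    hp.one_lt.ne' (Nat.dvd_one.mp (hcop ▸ Nat.dvd_gcd hpVY h))
  exact ⟨fun h => key (Dvd.dvd.mul_right h Z), fun h => key (Dvd.dvd.mul_left h w)⟩

/-- **S0 at the primes of `Z`.** For a coprime violator `w Z⁴ = v Y⁴ + a` with `a > 0` and a prime `p ∣ Z`:
`a v ≢ 0 (mod p)` and `−a v` is a square mod `p` (namely `(v Y²)²`). -/
theorem reciprocitySieve_at_Z {a v w Y Z p : ℕ} (hp : p.Prime) (hcop : Nat.Coprime (v * Y) (w * Z))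
    (heq : w * Z ^ 4 = v * Y ^ 4 + a) (_ha : 0 < a) (hpZ : p ∣ Z) :
    ((a * v : ℕ) : ZMod p) ≠ 0 ∧ IsSquare (-((a * v : ℕ) : ZMod p)) := by
  haveI := Fact.mk hp
  obtain ⟨hpv, hpY⟩ := reciprocitySieve_not_dvd_of_dvd_Z hp hcop hpZ
  have hZ0 : ((Z : ℕ) : ZMod p) = 0 := (ZMod.natCast_eq_zero_iff Z p).mpr hpZ
  -- reduce the equation mod p: `0 = v Y⁴ + a`
  have hred : ((v : ℕ) : ZMod p) * (Y : ZMod p) ^ 4 + (a : ZMod p) = 0 := by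
    have h := congrArg (fun n : ℕ => (n : ZMod p)) heq
    simp only [Nat.cast_mul, Nat.cast_pow, Nat.cast_add, hZ0] at h
    rw [← h]; ring
  -- `p ∤ a`: otherwise `p ∣ v Y⁴`
  have hpa : ¬ p ∣ a := by
    intro hpa
    have ha0 : ((a : ℕ) : ZMod p) = 0 := (ZMod.natCast_eq_zero_iff a p).mpr hpa
    have hvY : ((v * Y ^ 4 : ℕ) : ZMod p) = 0 := by
      push_cast; rw [ha0, add_zero] at hred; exact hred
    rw [ZMod.natCast_eq_zero_iff] at hvY
    rcases (Nat.Prime.dvd_mul hp).mp hvY with h | h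
    · exact hpv h
    · exact hpY (hp.dvd_of_dvd_pow h)
  refine ⟨?_, ⟨((v : ℕ) : ZMod p) * (Y : ZMod p) ^ 2, ?_⟩⟩
  · rw [Ne, ZMod.natCast_eq_zero_iff]
    intro h
    rcases (Nat.Prime.dvd_mul hp).mp h with h | h
    · exact hpa h
    · exact hpv h
  · have ha' : ((a : ℕ) : ZMod p) = -(((v : ℕ) : ZMod p) * (Y : ZMod p) ^ 4) := by
      rw [eq_neg_iff_add_eq_zero, add_comm]; exact hred
    push_cast
    rw [ha']
    ring

/-- **S0 at the primes of `Y`.** For a coprime violator `w Z⁴ = v Y⁴ + a` with `a > 0` and a prime `p ∣ Y`: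
`a w ≢ 0 (mod p)` and `a w` is a square mod `p` (namely `(w Z²)²`). -/
theorem reciprocitySieve_at_Y {a v w Y Z p : ℕ} (hp : p.Prime) (hcop : Nat.Coprime (v * Y) (w * Z))
    (heq : w * Z ^ 4 = v * Y ^ 4 + a) (_ha : 0 < a) (hpY : p ∣ Y) :
    ((a * w : ℕ) : ZMod p) ≠ 0 ∧ IsSquare ((a * w : ℕ) : ZMod p) := by
  haveI := Fact.mk hp
  obtain ⟨hpw, hpZ⟩ := reciprocitySieve_not_dvd_of_dvd_Y hp hcop hpY
  have hY0 : ((Y : ℕ) : ZMod p) = 0 := (ZMod.natCast_eq_zero_iff Y p).mpr hpY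
  -- reduce the equation mod p: `w Z⁴ = a`
  have hred : ((w : ℕ) : ZMod p) * (Z : ZMod p) ^ 4 = (a : ZMod p) := by
    have h := congrArg (fun n : ℕ => (n : ZMod p)) heq
    simp only [Nat.cast_mul, Nat.cast_pow, Nat.cast_add, hY0] at h
    rw [h]; ring
  -- `p ∤ a`: otherwise `p ∣ w Z⁴`
  have hpa : ¬ p ∣ a := by
    intro hpa
    have ha0 : ((a : ℕ) : ZMod p) = 0 := (ZMod.natCast_eq_zero_iff a p).mpr hpa
    have hwZ : ((w * Z ^ 4 : ℕ) : ZMod p) = 0 := by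
      push_cast; rw [hred, ha0]
    rw [ZMod.natCast_eq_zero_iff] at hwZ
    rcases (Nat.Prime.dvd_mul hp).mp hwZ with h | h
    · exact hpw h
    · exact hpZ (hp.dvd_of_dvd_pow h)
  refine ⟨?_, ⟨((w : ℕ) : ZMod p) * (Z : ZMod p) ^ 2, ?_⟩⟩
  · rw [Ne, ZMod.natCast_eq_zero_iff]
    intro h
    rcases (Nat.Prime.dvd_mul hp).mp h with h | h
    · exact hpa h
    · exact hpw h
  · push_cast
    rw [← hred]
    ring

/-- **Stub `stub_reciprocitySieve` (registered form, line `SketchIdeator5`; stratum S0 of the card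
`two-division-descent-anchor`).** For a coprime violator `w Z⁴ = v Y⁴ + a`, `a > 0`, and a prime `p`:
if `p ∣ Z` then `p ∤ a v` and `−a v ≡ □ (mod p)`; if `p ∣ Y` then `p ∤ a w` and `a w ≡ □ (mod p)`. -/
theorem stub_reciprocitySieve : ∀ a v w Y Z p : ℕ, p.Prime → Nat.Coprime (v * Y) (w * Z) → w * Z ^ 4 = v * Y ^ 4 + a → 0 < a → (p ∣ Z → ((a * v : ℕ) : ZMod p) ≠ 0 ∧ IsSquare (-((a * v : ℕ) : ZMod p))) ∧ (p ∣ Y → ((a * w : ℕ) : ZMod p) ≠ 0 ∧ IsSquare ((a * w : ℕ) : ZMod p)) :=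
  fun _a _v _w _Y _Z _p hp hcop heq ha =>
    ⟨fun hpZ => reciprocitySieve_at_Z hp hcop heq ha hpZ, fun hpY => reciprocitySieve_at_Y hp hcop heq ha hpY⟩

end Summit.ABC.ABC.Theorems.TowerFourSubLiouville
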